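import Mathlib
import HarnessLib

/-!
# Normal form of a complex skew-symmetric matrix under unitary congruence (Youla decomposition)

Every complex square matrix `A` with `Aᵀ = -A` can be written as
`A = Σ_a σ_a (ȳ_a x̄_aᵀ - x̄_a ȳ_aᵀ)` with `σ_a > 0` and `(x_a, y_a)_a` an orthonormal family in `ℂ^ι`
for the standard Hermitian inner product `star p ⬝ᵥ q` (bars denote complex conjugates);
equivalently, `A` is unitarily congruent to `0 ⊕ ⨁_a σ_a [[0, 1], [-1, 0]]`
(Horn–Johnson, *Matrix Analysis*, 2nd ed., Corollary 4.4.19; Youla 1961; Hua 1944; Zumino 1962).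
In many-body physics this is the canonical form of an antisymmetric two-particle ("pair",
"geminal") wavefunction (Yang 1962, Appendix A; Bloch–Messiah), which is how it is used in
`Literature/MathematicalPhysics/QuantumLattice/HubbardWave0RayleighProofs.lean`.

Everything in this file is proved. Declarations are deliberate dot-notation extensions of
Mathlib's `Matrix` namespace.

## Main results

* `Matrix.exists_pair_of_transpose_eq_neg` — deflation step: a non-zero skew-symmetric `A` admits
  orthonormal `x, y` and `σ > 0` with `A x = σ ȳ`, `A y = -σ x̄`, both orthogonal to `ker A`
  (`x` is a unit eigenvector of `Aᴴ A` for a positive eigenvalue `σ²`, `y = conj (A x) / σ`).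
* `Matrix.exists_skewNormalForm_of_transpose_eq_neg` — the normal form: there are `n`, an
  orthonormal family `(x_a, y_a)_{a < n}` of `2n` vectors (orthogonal to `ker A`, a strengthening
  kept from the induction) and `σ_a > 0` with `A = Σ_a σ_a (ȳ_a x̄_aᵀ - x̄_a ȳ_aᵀ)`
  (`vecMulVec p q` is the matrix `p qᵀ`). Proof by induction on the rank
  (`Matrix.exists_skewNormalForm_of_rank_le`): `A - σ (ȳ x̄ᵀ - x̄ ȳᵀ)` is again skew-symmetric and
  its kernel strictly contains `ker A`.

## References

* R. A. Horn, C. R. Johnson, *Matrix Analysis*, 2nd ed., Cambridge University Press (2013),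
  Corollary 4.4.19 (p. 270): a skew-symmetric `A ∈ M_n(ℂ)` has even rank `r`, its non-zero
  singular values occur in pairs, and `A` is unitarily congruent to
  `0_{n-r} ⊕ [[0, s_1], [-s_1, 0]] ⊕ ⋯ ⊕ [[0, s_{r/2}], [-s_{r/2}, 0]]`.
* D. C. Youla, *A normal form for a matrix under the unitary congruence group*,
  Canad. J. Math. **13** (1961) 694–704.
* B. Zumino, *Normal forms of complex matrices*, J. Math. Phys. **3** (1962) 1055–1057.
* C. N. Yang, Rev. Mod. Phys. **34** (1962) 694–704, Appendix A.

## Mathlib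

Mathlib has the spectral theorem for Hermitian matrices
(`Matrix.IsHermitian.exists_eigenvector_of_ne_zero`, used here), rank–nullity and
`Matrix.mul_eq_one_comm_of_equiv`, but no singular value / Autonne–Takagi / Youla decomposition
and no normal form of (skew-)symmetric matrices under congruence (`rg -i "takagi|youla|skew.?symm"`
in `Mathlib/LinearAlgebra` and `Mathlib/Analysis/Matrix` finds only `Matrix.J` of the symplectic
group).
-/

namespace Matrix

open Finset
open scoped ComplexOrder

variable {ι : Type*} [Fintype ι]

/-- For a skew-symmetric matrix the bilinear form `p ⬝ᵥ (A *ᵥ q)` is alternating: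
`p ⬝ᵥ A q = -(q ⬝ᵥ A p)`. [folklore] -/
theorem dotProduct_mulVec_of_transpose_eq_neg {A : Matrix ι ι ℂ} (hA : Aᵀ = -A)
    (p q : ι → ℂ) : p ⬝ᵥ (A *ᵥ q) = -(q ⬝ᵥ (A *ᵥ p)) := by
  conv_rhs => rw [dotProduct_mulVec, ← mulVec_transpose, hA, neg_mulVec, neg_dotProduct,
    neg_neg, dotProduct_comm]

/-- `p ⬝ᵥ A p = 0` for a skew-symmetric `A`. [folklore] -/
theorem dotProduct_mulVec_self_of_transpose_eq_neg {A : Matrix ι ι ℂ} (hA : Aᵀ = -A)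
    (p : ι → ℂ) : p ⬝ᵥ (A *ᵥ p) = 0 := by
  have h := dotProduct_mulVec_of_transpose_eq_neg hA p p
  linear_combination (1 / 2 : ℂ) * h

/-- `A (conj w) = -conj (Aᴴ w)` for a skew-symmetric `A`. [folklore] -/
theorem mulVec_star_of_transpose_eq_neg {A : Matrix ι ι ℂ} (hA : Aᵀ = -A) (w : ι → ℂ) :
    A *ᵥ star w = -star (Aᴴ *ᵥ w) := by
  apply star_injective
  rw [star_mulVec, star_neg, star_star, star_star, ← mulVec_transpose, conjTranspose_transpose,
    ← transpose_conjTranspose, hA, conjTranspose_neg, neg_mulVec]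

/-- `star w ⬝ᵥ w = Σ_i |w i|²` as a real number cast to `ℂ`. [folklore] -/
theorem star_dotProduct_self_eq_ofReal (w : ι → ℂ) :
    star w ⬝ᵥ w = ((∑ i, ‖w i‖ ^ 2 : ℝ) : ℂ) := by
  simp only [dotProduct, Pi.star_apply, Complex.ofReal_sum, Complex.ofReal_pow]
  refine Finset.sum_congr rfl fun i _ => ?_
  rw [Complex.star_def, Complex.conj_mul']

/-- `⟨M v, z⟩ = ⟨v, Mᴴ z⟩`. [folklore] -/
theorem star_mulVec_dotProduct' (M : Matrix ι ι ℂ) (v z : ι → ℂ) :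
    star (M *ᵥ v) ⬝ᵥ z = star v ⬝ᵥ (Mᴴ *ᵥ z) := by
  rw [star_mulVec, dotProduct_mulVec]

/-- **Deflation step.** A non-zero complex skew-symmetric matrix `A` admits orthonormal vectors
`x, y` and `σ > 0` with `A x = σ ȳ`, `A y = -σ x̄`, both orthogonal to `ker A` (take `x` a unit
eigenvector of `Aᴴ A` for a positive eigenvalue `σ²` and `y = conj (A x) / σ`); this is the
inductive step in the proof of the skew-symmetric normal form, Horn–Johnson (2013)
Corollary 4.4.19; Youla (1961); Zumino (1962). [cite: HornJohnson2013, Corollary 4.4.19] -/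
theorem exists_pair_of_transpose_eq_neg {A : Matrix ι ι ℂ} (hA : Aᵀ = -A) (h0 : A ≠ 0) :
    ∃ (x y : ι → ℂ) (σ : ℝ), 0 < σ ∧
      star x ⬝ᵥ x = 1 ∧ star y ⬝ᵥ y = 1 ∧ star x ⬝ᵥ y = 0 ∧
      A *ᵥ x = (σ : ℂ) • star y ∧ A *ᵥ y = -((σ : ℂ) • star x) ∧
      (∀ z, A *ᵥ z = 0 → star x ⬝ᵥ z = 0 ∧ star y ⬝ᵥ z = 0) := by
  set H := Aᴴ * A with hH
  have hHh : H.IsHermitian := isHermitian_conjTranspose_mul_self A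
  have hquad : ∀ v w : ι → ℂ, star v ⬝ᵥ (H *ᵥ w) = star (A *ᵥ v) ⬝ᵥ (A *ᵥ w) := fun v w => by
    rw [hH, ← mulVec_mulVec, star_mulVec_dotProduct']
  have hH0 : H ≠ 0 := by
    intro hz
    apply h0
    rw [ext_iff_mulVec]
    intro v
    rw [zero_mulVec, ← dotProduct_star_self_eq_zero, ← hquad, hz, zero_mulVec, dotProduct_zero]
  obtain ⟨v, t, ht, hv, hHv⟩ := hHh.exists_eigenvector_of_ne_zero hH0
  rw [RCLike.real_smul_eq_coe_smul (K := ℂ)] at hHv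
  -- norms
  set r : ℝ := ∑ i, ‖v i‖ ^ 2 with hr
  have hvv : star v ⬝ᵥ v = (r : ℂ) := star_dotProduct_self_eq_ofReal v
  have hr0 : 0 < r := by
    obtain ⟨i, hi⟩ : ∃ i, v i ≠ 0 := by
      by_contra h
      exact hv (funext fun i => not_not.mp (not_exists.mp h i))
    rw [hr]
    exact lt_of_lt_of_le (by positivity : (0 : ℝ) < ‖v i‖ ^ 2)
      (Finset.single_le_sum (f := fun j => ‖v j‖ ^ 2) (fun j _ => by positivity)
        (Finset.mem_univ i))
  -- `t > 0`
  have ht0 : 0 < t := by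
    have h1 : star v ⬝ᵥ (H *ᵥ v) = (t : ℂ) * (r : ℂ) := by
      rw [hHv, dotProduct_smul, hvv, smul_eq_mul]
      rfl
    rw [hquad, star_dotProduct_self_eq_ofReal] at h1
    have h2 : ∑ i, ‖(A *ᵥ v) i‖ ^ 2 = t * r := by exact_mod_cast h1
    have h3 : 0 ≤ t * r := h2 ▸ Finset.sum_nonneg fun i _ => by positivity
    rcases lt_trichotomy t 0 with hlt | heq | hgt
    · exact absurd h3 (not_le.mpr (mul_neg_of_neg_of_pos hlt hr0))
    · exact absurd heq ht
    · exact hgt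
  -- the unit vector `x`
  set c : ℝ := (Real.sqrt r)⁻¹ with hc
  have hc2 : c * c * r = 1 := by
    rw [hc, ← mul_inv, Real.mul_self_sqrt hr0.le, inv_mul_cancel₀ hr0.ne']
  set x : ι → ℂ := (c : ℂ) • v with hx
  have hstarx : star x = (c : ℂ) • star v := by
    rw [hx, star_smul, Complex.star_def, Complex.conj_ofReal]
  have hxx : star x ⬝ᵥ x = 1 := by
    rw [hstarx, hx, smul_dotProduct, dotProduct_smul, hvv, smul_eq_mul, smul_eq_mul, ← mul_assoc]
    exact_mod_cast hc2
  have hHx : H *ᵥ x = (t : ℂ) • x := by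
    rw [hx, mulVec_smul, hHv]
    exact smul_comm _ _ _
  -- `σ` and `y`
  set σ : ℝ := Real.sqrt t with hσ
  have hσ0 : 0 < σ := Real.sqrt_pos.mpr ht0
  have hσ2 : σ * σ = t := Real.mul_self_sqrt ht0.le
  have hσC : (σ : ℂ) ≠ 0 := Complex.ofReal_ne_zero.mpr hσ0.ne'
  set y : ι → ℂ := ((σ : ℂ)⁻¹) • star (A *ᵥ x) with hy
  have hstary : star y = ((σ : ℂ)⁻¹) • (A *ᵥ x) := by
    rw [hy, star_smul, star_inv₀, Complex.star_def, Complex.conj_ofReal, star_star]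
  have hAx : A *ᵥ x = (σ : ℂ) • star y := by
    rw [hstary, smul_smul, mul_inv_cancel₀ hσC, one_smul]
  have hxy : star x ⬝ᵥ y = 0 := by
    rw [hy, dotProduct_smul, star_dotProduct_star, dotProduct_comm,
      dotProduct_mulVec_self_of_transpose_eq_neg hA, star_zero, smul_zero]
  have hyy : star y ⬝ᵥ y = 1 := by
    rw [hstary, hy, smul_dotProduct, dotProduct_smul, dotProduct_comm, ← hquad, hHx,
      dotProduct_smul, hxx, smul_eq_mul, smul_eq_mul, smul_eq_mul, mul_one, ← hσ2,
      Complex.ofReal_mul]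
    field_simp
  have hAy : A *ᵥ y = -((σ : ℂ) • star x) := by
    rw [hy, mulVec_smul, mulVec_star_of_transpose_eq_neg hA, mulVec_mulVec, ← hH, hHx,
      star_smul, Complex.star_def, Complex.conj_ofReal, smul_neg, smul_smul, ← hσ2,
      Complex.ofReal_mul, ← mul_assoc, inv_mul_cancel₀ hσC, one_mul]
  have hker : ∀ z, A *ᵥ z = 0 → star x ⬝ᵥ z = 0 ∧ star y ⬝ᵥ z = 0 := by
    intro z hz
    constructor
    · have h1 : star (H *ᵥ x) ⬝ᵥ z = 0 := by
        rw [star_mulVec_dotProduct', hHh.eq, hH, ← mulVec_mulVec, hz, mulVec_zero, dotProduct_zero]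
      rw [hHx, star_smul, Complex.star_def, Complex.conj_ofReal, smul_dotProduct, smul_eq_mul] at h1
      exact (mul_eq_zero.mp h1).resolve_left (Complex.ofReal_ne_zero.mpr ht0.ne')
    · rw [hstary, smul_dotProduct, dotProduct_comm, dotProduct_mulVec_of_transpose_eq_neg hA, hz,
        dotProduct_zero, neg_zero, smul_zero]
  exact ⟨x, y, σ, hσ0, hxx, hyy, hxy, hAx, hAy, hker⟩

/-- The zero matrix has the empty skew normal form. [folklore] -/
theorem exists_skewNormalForm_zero :
    ∃ (n : ℕ) (x y : Fin n → ι → ℂ) (σ : Fin n → ℝ),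
      (∀ a, 0 < σ a) ∧
      (∀ a b, star (x a) ⬝ᵥ x b = if a = b then 1 else 0) ∧
      (∀ a b, star (y a) ⬝ᵥ y b = if a = b then 1 else 0) ∧
      (∀ a b, star (x a) ⬝ᵥ y b = 0) ∧
      (∀ z, (0 : Matrix ι ι ℂ) *ᵥ z = 0 → ∀ a, star (x a) ⬝ᵥ z = 0 ∧ star (y a) ⬝ᵥ z = 0) ∧
      (0 : Matrix ι ι ℂ) = ∑ a, ((σ a : ℝ) : ℂ) •
        (vecMulVec (star (y a)) (star (x a)) - vecMulVec (star (x a)) (star (y a))) :=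
  ⟨0, Fin.elim0, Fin.elim0, Fin.elim0, fun a => Fin.elim0 a, fun a => Fin.elim0 a,
    fun a => Fin.elim0 a, fun a => Fin.elim0 a, fun _ _ a => Fin.elim0 a, by simp⟩

/-- `(p qᵀ) z = (q ⬝ᵥ z) p`. [folklore] -/
theorem vecMulVec_mulVec' (p q z : ι → ℂ) : vecMulVec p q *ᵥ z = (q ⬝ᵥ z) • p := by
  rw [vecMulVec_mulVec, op_smul_eq_smul]

/-- **Normal form of a complex skew-symmetric matrix**, with an explicit rank bound for the
induction: every `A` with `Aᵀ = -A` and `rank A ≤ d` has a skew normal form.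
Horn–Johnson (2013) Corollary 4.4.19; Youla (1961). [cite: HornJohnson2013, Corollary 4.4.19] -/
theorem exists_skewNormalForm_of_rank_le [DecidableEq ι] : ∀ (d : ℕ) (A : Matrix ι ι ℂ), Aᵀ = -A →
    Module.finrank ℂ (LinearMap.range (Matrix.toLin' A)) ≤ d →
    ∃ (n : ℕ) (x y : Fin n → ι → ℂ) (σ : Fin n → ℝ),
      (∀ a, 0 < σ a) ∧
      (∀ a b, star (x a) ⬝ᵥ x b = if a = b then 1 else 0) ∧
      (∀ a b, star (y a) ⬝ᵥ y b = if a = b then 1 else 0) ∧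
      (∀ a b, star (x a) ⬝ᵥ y b = 0) ∧
      (∀ z, A *ᵥ z = 0 → ∀ a, star (x a) ⬝ᵥ z = 0 ∧ star (y a) ⬝ᵥ z = 0) ∧
      A = ∑ a, ((σ a : ℝ) : ℂ) •
        (vecMulVec (star (y a)) (star (x a)) - vecMulVec (star (x a)) (star (y a))) := by
  intro d
  induction d with
  | zero =>
    intro A hA hd
    have h0 : A = 0 := by
      have h1 : LinearMap.range (Matrix.toLin' A) = ⊥ :=
        Submodule.finrank_eq_zero.mp (Nat.le_zero.mp hd)
      exact (LinearEquiv.map_eq_zero_iff Matrix.toLin').mp (LinearMap.range_eq_bot.mp h1)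
    rw [h0]
    exact exists_skewNormalForm_zero
  | succ d ih =>
    intro A hA hd
    by_cases h0 : A = 0
    · rw [h0]; exact exists_skewNormalForm_zero
    obtain ⟨x, y, σ, hσ, hxx, hyy, hxy, hAx, hAy, hker⟩ := exists_pair_of_transpose_eq_neg hA h0
    have hyx : star y ⬝ᵥ x = 0 := by rw [star_dotProduct, hxy, star_zero]
    set D : Matrix ι ι ℂ := (σ : ℂ) •
      (vecMulVec (star y) (star x) - vecMulVec (star x) (star y)) with hD
    set A' := A - D with hA'
    have hDz : ∀ z, D *ᵥ z = (σ : ℂ) • ((star x ⬝ᵥ z) • star y - (star y ⬝ᵥ z) • star x) := by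
      intro z
      rw [hD, smul_mulVec, sub_mulVec, vecMulVec_mulVec', vecMulVec_mulVec']
    have hA't : A'ᵀ = -A' := by
      rw [hA', hD, transpose_sub, transpose_smul, transpose_sub, transpose_vecMulVec,
        transpose_vecMulVec, hA]
      ext i j
      simp only [sub_apply, neg_apply, smul_apply, smul_eq_mul]
      ring
    have hkerle : ∀ z, A *ᵥ z = 0 → A' *ᵥ z = 0 := by
      intro z hz
      rw [hA', sub_mulVec, hz, hDz, (hker z hz).1, (hker z hz).2, zero_smul, zero_smul, sub_zero,
        smul_zero, sub_zero]
    have hA'x : A' *ᵥ x = 0 := by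
      rw [hA', sub_mulVec, hDz, hxx, hyx, one_smul, zero_smul, sub_zero, hAx, sub_self]
    have hA'y : A' *ᵥ y = 0 := by
      rw [hA', sub_mulVec, hDz, hxy, hyy, zero_smul, one_smul, zero_sub, smul_neg, hAy,
        sub_self]
    have hAx0 : A *ᵥ x ≠ 0 := by
      rw [hAx]
      intro h
      rw [smul_eq_zero] at h
      rcases h with h | h
      · exact (Complex.ofReal_ne_zero.mpr hσ.ne') h
      · have : star y ⬝ᵥ y = 0 := by rw [h, zero_dotProduct]
        rw [hyy] at this
        exact one_ne_zero this
    have hlt : LinearMap.ker (Matrix.toLin' A) < LinearMap.ker (Matrix.toLin' A') := by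
      refine lt_of_le_of_ne (fun z hz => ?_) (fun h => hAx0 ?_)
      · rw [LinearMap.mem_ker, Matrix.toLin'_apply] at hz ⊢
        exact hkerle z hz
      · have hx' : x ∈ LinearMap.ker (Matrix.toLin' A') := by
          rw [LinearMap.mem_ker, Matrix.toLin'_apply]; exact hA'x
        rw [← h, LinearMap.mem_ker, Matrix.toLin'_apply] at hx'
        exact hx'
    have hd' : Module.finrank ℂ (LinearMap.range (Matrix.toLin' A')) ≤ d := by
      have h1 := LinearMap.finrank_range_add_finrank_ker (Matrix.toLin' A)
      have h2 := LinearMap.finrank_range_add_finrank_ker (Matrix.toLin' A')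
      have h3 := Submodule.finrank_lt_finrank_of_lt hlt
      omega
    obtain ⟨n, x', y', σ', hσ', hxx', hyy', hxy', hker', hA'eq⟩ := ih A' hA't hd'
    -- orthogonality of the new pair to the old family
    have ox : ∀ a, star (x' a) ⬝ᵥ x = 0 ∧ star (y' a) ⬝ᵥ x = 0 := hker' x hA'x
    have oy : ∀ a, star (x' a) ⬝ᵥ y = 0 ∧ star (y' a) ⬝ᵥ y = 0 := hker' y hA'y
    have flip : ∀ p q : ι → ℂ, star p ⬝ᵥ q = 0 → star q ⬝ᵥ p = 0 := fun p q h => by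
      rw [star_dotProduct, h, star_zero]
    refine ⟨n + 1, Fin.cons x x', Fin.cons y y', Fin.cons σ σ', ?_, ?_, ?_, ?_, ?_, ?_⟩
    · intro a
      refine Fin.cases ?_ (fun a => ?_) a
      · simpa using hσ
      · simpa using hσ' a
    · intro a b
      refine Fin.cases ?_ (fun a => ?_) a <;> refine Fin.cases ?_ (fun b => ?_) b
      · simpa using hxx
      · simpa [(Fin.succ_ne_zero b).symm] using flip _ _ (ox b).1
      · simpa [Fin.succ_ne_zero a] using (ox a).1
      · simpa [Fin.succ_inj] using hxx' a b
    · intro a b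
      refine Fin.cases ?_ (fun a => ?_) a <;> refine Fin.cases ?_ (fun b => ?_) b
      · simpa using hyy
      · simpa [(Fin.succ_ne_zero b).symm] using flip _ _ (oy b).2
      · simpa [Fin.succ_ne_zero a] using (oy a).2
      · simpa [Fin.succ_inj] using hyy' a b
    · intro a b
      refine Fin.cases ?_ (fun a => ?_) a <;> refine Fin.cases ?_ (fun b => ?_) b
      · simpa using hxy
      · simpa using flip _ _ (ox b).2
      · simpa using (oy a).1
      · simpa using hxy' a b
    · intro z hz a
      refine Fin.cases ?_ (fun a => ?_) a
      · simpa using hker z hz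
      · simpa using hker' z (hkerle z hz) a
    · rw [Fin.sum_univ_succ]
      simp only [Fin.cons_zero, Fin.cons_succ]
      rw [← hA'eq, hA', hD, add_sub_cancel]

/-- **Normal form (Youla decomposition) of a complex skew-symmetric matrix**: every `A` with
`Aᵀ = -A` is `Σ_a σ_a (ȳ_a x̄_aᵀ - x̄_a ȳ_aᵀ)` with `σ_a > 0` and `(x_a, y_a)_a` an orthonormal
family (orthogonal to `ker A`). Horn–Johnson, *Matrix Analysis* (2013), Corollary 4.4.19;
D. C. Youla, Canad. J. Math. 13 (1961) 694–704; B. Zumino, J. Math. Phys. 3 (1962) 1055.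
[cite: HornJohnson2013, Corollary 4.4.19] -/
theorem exists_skewNormalForm_of_transpose_eq_neg (A : Matrix ι ι ℂ) (hA : Aᵀ = -A) :
    ∃ (n : ℕ) (x y : Fin n → ι → ℂ) (σ : Fin n → ℝ),
      (∀ a, 0 < σ a) ∧
      (∀ a b, star (x a) ⬝ᵥ x b = if a = b then 1 else 0) ∧
      (∀ a b, star (y a) ⬝ᵥ y b = if a = b then 1 else 0) ∧
      (∀ a b, star (x a) ⬝ᵥ y b = 0) ∧
      (∀ z, A *ᵥ z = 0 → ∀ a, star (x a) ⬝ᵥ z = 0 ∧ star (y a) ⬝ᵥ z = 0) ∧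
      A = ∑ a, ((σ a : ℝ) : ℂ) •
        (vecMulVec (star (y a)) (star (x a)) - vecMulVec (star (x a)) (star (y a))) := by
  classical
  exact exists_skewNormalForm_of_rank_le _ A hA le_rfl

end Matrix
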